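import Summits.ResolutionOfSingularities.ResolutionOfSingularities.Theorems.WeightedInvariantContactCylinderOpenClauseRegime
import Summits.ResolutionOfSingularities.ResolutionOfSingularities.Theorems.WeightedInvariantWeightedConstructionCobordantBlowupRegular
import Summits.ResolutionOfSingularities.ResolutionOfSingularities.Theorems.WeightedInvariantHypersurfaceCentreAssemblyPullback
import Literature.AlgebraicGeometry.Resolution.CobordantBlowupExtReesBridge
import HarnessLib

/-!
# THE GLOBAL CYLINDER MOVE: one weighted centre on a basic open along the curve, of finite type over the model ring, whose
# localisation at every point of the curve is the local cobordant move (ORDER (o28); res-L1-w43-plan-1 RULING gen 11 #5 (1) /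
# #6 (4), for res-type-047's (D2) «finiteness of tie points»; interface = res-type-005's (R1)–(R4) 13:23:52Z)
# (door `HypersurfaceCentreConstruction`, stmt-ResolutionOfSingularities-19897; KEY `stub_localWeightedDropEFT4S`, regime P3a)

Topic: `Summits/ResolutionOfSingularities/ResolutionOfSingularities/Theorems`. Helper for the door item
`HypersurfaceCentreConstruction` (stmt-ResolutionOfSingularities-19897, route `WeightedInvariant`), line `local-engine` of
res-L1-w43-plan-1 (L W4.3).  No new objects.  The GLOBAL move over the model ring `A` (any commutative ring, any `U : Fin m → A`,
weights `W`) is the extended Rees algebra `B = (weightedFiltration U W).extendedRees = ⊕ 𝒥ₙ tⁿ ⊕ A[t⁻¹]` of the ONE weighted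
centre `(U; W)` — for the cylinder pair, `U = ![x', g']`, `W = ![1, b_max]` are produced on `D(h) ∋ 𝔪` by
`jOpenPresentation_body_cylinder_iotaOrd_of_regime` (p533562), with `(𝒥ₙ A_𝔮) = jCylinder iotaOrd jContact (A_𝔮) F n` at every
`𝔮 ∈ V(U) ∩ D(h)`.  (G1) `B` EQUALS res-type-048's `cobordantAlgebra U W = A[t⁻¹, uᵢ t^{wᵢ}]` as a subalgebra of `A[t, t⁻¹]`, hence
is of finite type over `A` (one morphism `Spec B → Spec A`, locally of finite presentation over a Noetherian `A`).  (G2)+(G3) at a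
prime `𝔮` and a prime `𝔫` of `B` over a generisation of `𝔮`: for ANY presentation `I'` of the localised pieces
(`I' n = 𝒥ₙ A_𝔮` — e.g. `weightedMonomialIdeal (U/1) W n`, or `jCylinder … n` by p533562) there are a prime `𝔫'` of the LOCAL move
`extReesAlgebra I'` over `A_𝔮` and ONE ring isomorphism `g : B_𝔫 ≃+* (extReesAlgebra I')_{𝔫'}` (a literal `≃+*` binder, (R2)) with
the packaged dictionary (i) structure maps from `A`, (ii) `t⁻¹`, (iii) vertex/irrelevant, (iv) base primes, (v) `g (t⁻¹/1) = t⁻¹/1`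
(`LocalEngine.exists_prime_extReesAlgebra_ringEquiv_localization_T`, p509387 lineage of res-type-048's p505694/p506584).

[OURS · L1 W4.3 · (o28) P3a]  Replaces the role of NO printed item; NOT a statement of the manuscript
[claim: Hironaka2017, status: under-review]. AI work, weaker than expert review.  Pure commutative algebra; no named facts;
dimension-free ((R4)).

## References

* J. Włodarczyk, *Functorial resolution except for toroidal locus. Toroidal compactification*, Def. 2.3.5, 5.1.1. [Wlodarczyk2022]
* res-L1-w43-plan-1 RULING gen 11 #5/#6; res-type-005 INTERFACE INPUT (R1)–(R4) 2026-08-27T13:23:52Z (OURS, AI planning).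
-/

noncomputable section

open IsLocalRing Literature.AlgebraicGeometry.Resolution LaurentPolynomial
open Summit.ResolutionOfSingularities.ResolutionOfSingularities.Cruxes.HypersurfaceCentreConstruction.LocalEngine

set_option linter.dupNamespace false -- mandated namespace of this single-conjunct summit

namespace Summit.ResolutionOfSingularities.ResolutionOfSingularities.Theorems

namespace ContactCylinder

/-! ## (G1) the global move is the cobordant algebra, of finite type -/

/-- The pieces of `weightedFiltration U W` are the weighted monomial ideals. [folklore] -/
theorem weightedFiltration_ideal_eq {A : Type} [CommRing A] {m : ℕ} (U : Fin m → A) (W : Fin m → ℕ) :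
    (weightedFiltration U W).ideal = weightedMonomialIdeal U W := by
  funext n
  rw [weightedFiltration_ideal, weightedMonomialIdeal_eq_span_weightedMonomials]

/-- The pieces of the weighted filtration of `(U; W)` extend to the weighted monomial ideals of the images ((R3)'s `hI'` for the
presentation `I' = weightedMonomialIdeal (φ ∘ U) W`). [folklore] -/
theorem weightedFiltration_ideal_map {A A' : Type} [CommRing A] [CommRing A'] (φ : A →+* A') {m : ℕ} (U : Fin m → A)
    (W : Fin m → ℕ) (n : ℕ) :
    weightedMonomialIdeal (fun i => φ (U i)) W n = ((weightedFiltration U W).ideal n).map φ := by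
  rw [weightedFiltration_ideal_eq, weightedMonomialIdeal_map]

/-- **(G1) The global move `⊕ 𝒥ₙ tⁿ ⊕ A[t⁻¹]` of a weighted centre EQUALS the cobordant algebra `A[t⁻¹, uᵢ t^{wᵢ}]`** (as
subalgebras of `A[t, t⁻¹]`; res-type-048's bridge). [cite: Wlodarczyk2022, Def. 2.3.5] -/
theorem extendedRees_weightedFiltration_eq_cobordantAlgebra {A : Type} [CommRing A] {m : ℕ} (U : Fin m → A) (W : Fin m → ℕ) :
    (weightedFiltration U W).extendedRees = cobordantAlgebra U W := by
  rw [← (weightedFiltration U W).extReesAlgebra_ideal_eq_extendedRees, weightedFiltration_ideal_eq,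
    extReesAlgebra_weightedMonomialIdeal_eq_cobordantAlgebra]

/-- **(G1) The global move is of finite type over the model ring** — so `Spec (⊕ 𝒥ₙ tⁿ ⊕ A[t⁻¹]) → Spec A` is ONE morphism,
locally of finite presentation when `A` is Noetherian. [cite: Wlodarczyk2022, Def. 2.3.5] -/
theorem finiteType_extendedRees_weightedFiltration {A : Type} [CommRing A] {m : ℕ} (U : Fin m → A) (W : Fin m → ℕ) :
    Algebra.FiniteType A (weightedFiltration U W).extendedRees := by
  rw [extendedRees_weightedFiltration_eq_cobordantAlgebra]
  exact finiteType_cobordantAlgebra U W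

/-! ## (G2)+(G3) localisation at a point of the curve = the local move, with the packaged prime dictionary -/

/-- **(G2)+(G3) LOCAL RINGS OF THE GLOBAL MOVE OVER `𝔮` ARE LOCAL RINGS OF THE LOCAL MOVE AT `𝔮`.**  `A` any commutative ring,
`(U; W)` a weighted centre on `A` with global move `B = (weightedFiltration U W).extendedRees`; `𝔮` a prime, `I' : ℕ → Ideal A_𝔮`
ANY presentation of the localised pieces (`I' n = 𝒥ₙ A_𝔮`); `𝔫` a prime of `B` missing `A ∖ 𝔮`.  Then there are a prime `𝔫'` of
the LOCAL move `extReesAlgebra I'` over `A_𝔮` and ONE `g : B_𝔫 ≃+* (extReesAlgebra I')_{𝔫'}` with: (i) the structure maps from `A`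
match; (ii) `t⁻¹ ∈ 𝔫' ↔ t⁻¹ ∈ 𝔫`; (iii) `vertexIdeal ≤ 𝔫' ↔ irrelevant ≤ 𝔫`; (iv) for every `𝔭 ≤ A`,
`(𝔭 A_𝔮) · extReesAlgebra I' ≤ 𝔫' ↔ 𝔭 · B ≤ 𝔫`; (v) `g (t⁻¹/1) = t⁻¹/1`.  (`LocalEngine.exists_prime_extReesAlgebra_ringEquiv_localization_T`
instantiated; for the cylinder pair take `I' n = weightedMonomialIdeal (U/1) W n` (`weightedFiltration_ideal_map`) or
`I' n = jCylinder iotaOrd jContact (A_𝔮) F n` on `V(U) ∩ D(h)` (p533562).) [cite: Wlodarczyk2022, Def. 5.1.1] -/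
theorem exists_prime_localMove_ringEquiv {A : Type} [CommRing A] {m : ℕ} (U : Fin m → A) (W : Fin m → ℕ)
    (𝔮 : Ideal A) [𝔮.IsPrime] {I' : ℕ → Ideal (Localization.AtPrime 𝔮)}
    (hI' : ∀ n, I' n = ((weightedFiltration U W).ideal n).map (algebraMap A (Localization.AtPrime 𝔮)))
    (𝔫 : Ideal (weightedFiltration U W).extendedRees) [𝔫.IsPrime]
    (hd : Disjoint ((𝔮.primeCompl.map (algebraMap A (weightedFiltration U W).extendedRees) :
      Submonoid (weightedFiltration U W).extendedRees) : Set (weightedFiltration U W).extendedRees) 𝔫) :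
    ∃ (𝔫' : Ideal (extReesAlgebra I')) (_ : 𝔫'.IsPrime) (g : Localization.AtPrime 𝔫 ≃+* Localization.AtPrime 𝔫'),
      (∀ a : A, g (algebraMap (weightedFiltration U W).extendedRees (Localization.AtPrime 𝔫)
            (algebraMap A (weightedFiltration U W).extendedRees a)) =
          algebraMap (extReesAlgebra I') (Localization.AtPrime 𝔫')
            (algebraMap (Localization.AtPrime 𝔮) (extReesAlgebra I') (algebraMap A (Localization.AtPrime 𝔮) a))) ∧
      (extReesAlgebra.tInv I' ∈ 𝔫' ↔
        (⟨T (-1), (weightedFiltration U W).T_neg_one_mem_extendedRees⟩ : (weightedFiltration U W).extendedRees) ∈ 𝔫) ∧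
      (extReesAlgebra.vertexIdeal I' ≤ 𝔫' ↔ (weightedFiltration U W).irrelevant ≤ 𝔫) ∧
      (∀ 𝔭 : Ideal A, (𝔭.map (algebraMap A (Localization.AtPrime 𝔮))).map
          (algebraMap (Localization.AtPrime 𝔮) (extReesAlgebra I')) ≤ 𝔫' ↔
        𝔭.map (algebraMap A (weightedFiltration U W).extendedRees) ≤ 𝔫) ∧
      g (algebraMap (weightedFiltration U W).extendedRees (Localization.AtPrime 𝔫)
          (⟨T (-1), (weightedFiltration U W).T_neg_one_mem_extendedRees⟩ : (weightedFiltration U W).extendedRees)) =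
        algebraMap (extReesAlgebra I') (Localization.AtPrime 𝔫') (extReesAlgebra.tInv I') :=
  exists_prime_extReesAlgebra_ringEquiv_localization_T (weightedFiltration U W) 𝔮.primeCompl hI' 𝔫 hd

/-- **The same for the literal local move `cobordantAlgebra' (U/1) W`** of the (drop) clause (`I' n = weightedMonomialIdeal (U/1) W n`).
[cite: Wlodarczyk2022, Def. 5.1.1] -/
theorem exists_prime_cobordantAlgebra'_ringEquiv {A : Type} [CommRing A] {m : ℕ} (U : Fin m → A) (W : Fin m → ℕ)
    (𝔮 : Ideal A) [𝔮.IsPrime] (𝔫 : Ideal (weightedFiltration U W).extendedRees) [𝔫.IsPrime]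
    (hd : Disjoint ((𝔮.primeCompl.map (algebraMap A (weightedFiltration U W).extendedRees) :
      Submonoid (weightedFiltration U W).extendedRees) : Set (weightedFiltration U W).extendedRees) 𝔫) :
    ∃ (𝔫' : Ideal (cobordantAlgebra' (fun i => algebraMap A (Localization.AtPrime 𝔮) (U i)) W)) (_ : 𝔫'.IsPrime)
      (g : Localization.AtPrime 𝔫 ≃+* Localization.AtPrime 𝔫'),
      (∀ a : A, g (algebraMap (weightedFiltration U W).extendedRees (Localization.AtPrime 𝔫)
            (algebraMap A (weightedFiltration U W).extendedRees a)) =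
          algebraMap (cobordantAlgebra' (fun i => algebraMap A (Localization.AtPrime 𝔮) (U i)) W) (Localization.AtPrime 𝔫')
            (algebraMap (Localization.AtPrime 𝔮) (cobordantAlgebra' (fun i => algebraMap A (Localization.AtPrime 𝔮) (U i)) W)
              (algebraMap A (Localization.AtPrime 𝔮) a))) ∧
      (cobordantT' (fun i => algebraMap A (Localization.AtPrime 𝔮) (U i)) W ∈ 𝔫' ↔
        (⟨T (-1), (weightedFiltration U W).T_neg_one_mem_extendedRees⟩ : (weightedFiltration U W).extendedRees) ∈ 𝔫) ∧
      (extReesAlgebra.vertexIdeal (weightedMonomialIdeal (fun i => algebraMap A (Localization.AtPrime 𝔮) (U i)) W) ≤ 𝔫' ↔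
        (weightedFiltration U W).irrelevant ≤ 𝔫) ∧
      (∀ 𝔭 : Ideal A, (𝔭.map (algebraMap A (Localization.AtPrime 𝔮))).map
          (algebraMap (Localization.AtPrime 𝔮) (cobordantAlgebra' (fun i => algebraMap A (Localization.AtPrime 𝔮) (U i)) W)) ≤ 𝔫' ↔
          𝔭.map (algebraMap A (weightedFiltration U W).extendedRees) ≤ 𝔫) ∧
      g (algebraMap (weightedFiltration U W).extendedRees (Localization.AtPrime 𝔫)
          (⟨T (-1), (weightedFiltration U W).T_neg_one_mem_extendedRees⟩ : (weightedFiltration U W).extendedRees)) =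
        algebraMap (cobordantAlgebra' (fun i => algebraMap A (Localization.AtPrime 𝔮) (U i)) W) (Localization.AtPrime 𝔫')
          (cobordantT' (fun i => algebraMap A (Localization.AtPrime 𝔮) (U i)) W) :=
  exists_prime_localMove_ringEquiv U W 𝔮 (fun n => weightedFiltration_ideal_map (algebraMap A (Localization.AtPrime 𝔮)) U W n) 𝔫 hd

/-- **`𝔫` over the point `𝔮` misses `A ∖ 𝔮`**: the disjointness binder of the package from the base-point condition `𝔮 · B ≤ 𝔫`
together with `𝔫 ∩ A ≠ ⊤`-type primality (`𝔫 ∩ A = 𝔮` suffices). [folklore] -/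
theorem disjoint_map_primeCompl_of_comap_eq {A B : Type} [CommRing A] [CommRing B] [Algebra A B] (𝔮 : Ideal A)
    [𝔮.IsPrime] (𝔫 : Ideal B) (h : 𝔫.comap (algebraMap A B) = 𝔮) :
    Disjoint ((𝔮.primeCompl.map (algebraMap A B) : Submonoid B) : Set B) 𝔫 := by
  refine Set.disjoint_left.mpr ?_
  rintro _ ⟨a, ha, rfl⟩ hmem
  exact ha (h ▸ (Ideal.mem_comap.mpr hmem))

/-! ## (G2′)/(vi)–(vii): the ring map `ψ : B → B_𝔮`, the `IsLocalization` shape, and full compatibility of `g` on `B`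
(res-type-047's shape 13:33:01Z and res-type-005's (vi) 13:35:05Z) -/

/-- **(G2′) THE LOCAL MOVE IS THE LOCALISATION OF THE GLOBAL MOVE.**  For ANY presentation `I'` of the localised pieces there is a
ring map `ψ : B = ⊕ 𝒥ₙ tⁿ ⊕ A[t⁻¹] → extReesAlgebra I'` which is COEFFICIENTWISE the localisation `A → A_𝔮` on Laurent
polynomials (so `t⁻¹ ↦ t⁻¹`, `a tⁿ ↦ (a/1) tⁿ`, structure maps match), and `extReesAlgebra I'` IS the localisation of `B` at the
image of `A ∖ 𝔮` for the algebra structure `ψ` (res-type-048's `IdealFiltration.isLocalization_extendedRees` transported along the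
identification `extReesAlgebra I' ≃ ⊕ 𝒥ₙ' tⁿ`). [cite: Wlodarczyk2022, Def. 5.1.1] -/
theorem exists_ringHom_localMove_isLocalization {A : Type} [CommRing A] {m : ℕ} (U : Fin m → A) (W : Fin m → ℕ)
    (𝔮 : Ideal A) [𝔮.IsPrime] {I' : ℕ → Ideal (Localization.AtPrime 𝔮)}
    (hI' : ∀ n, I' n = ((weightedFiltration U W).ideal n).map (algebraMap A (Localization.AtPrime 𝔮))) :
    ∃ ψ : (weightedFiltration U W).extendedRees →+* extReesAlgebra I',
      (∀ b : (weightedFiltration U W).extendedRees, ((ψ b : extReesAlgebra I') : (Localization.AtPrime 𝔮)[T;T⁻¹]) =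
          AddMonoidAlgebra.mapRingHom ℤ (algebraMap A (Localization.AtPrime 𝔮)) (b : A[T;T⁻¹])) ∧
      (∀ a : A, ψ (algebraMap A (weightedFiltration U W).extendedRees a) =
          algebraMap (Localization.AtPrime 𝔮) (extReesAlgebra I') (algebraMap A (Localization.AtPrime 𝔮) a)) ∧
      ψ (⟨T (-1), (weightedFiltration U W).T_neg_one_mem_extendedRees⟩ : (weightedFiltration U W).extendedRees) =
        extReesAlgebra.tInv I' ∧
      @IsLocalization _ _ (𝔮.primeCompl.map (algebraMap A (weightedFiltration U W).extendedRees)) (extReesAlgebra I') _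
        ψ.toAlgebra := by
  let F' : IdealFiltration (Localization.AtPrime 𝔮) :=
    { ideal := I'
      ideal_zero := by rw [hI' 0, (weightedFiltration U W).ideal_zero, Ideal.map_top]
      antitone := fun a b h => by rw [hI' a, hI' b]; exact Ideal.map_mono ((weightedFiltration U W).antitone h)
      mul_le := fun a b => by
        rw [hI' a, hI' b, hI' (a + b), ← Ideal.map_mul]
        exact Ideal.map_mono ((weightedFiltration U W).mul_le a b) }
  have heq : ∀ n, F'.ideal n = ((weightedFiltration U W).ideal n).map (algebraMap A (Localization.AtPrime 𝔮)) := hI'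
  have hle : ∀ n, ((weightedFiltration U W).ideal n).map (algebraMap A (Localization.AtPrime 𝔮)) ≤ F'.ideal n :=
    fun n => (heq n).ge
  have hF'I : F'.ideal = I' := rfl
  obtain ⟨e, he⟩ := F'.exists_ringEquiv_extReesAlgebra hF'I
  refine ⟨e.symm.toRingHom.comp ((weightedFiltration U W).extendedReesMap F' hle), fun b => ?_, fun a => ?_, ?_, ?_⟩
  · rw [RingHom.comp_apply, RingEquiv.toRingHom_eq_coe, RingEquiv.coe_toRingHom, coe_symm_apply_eq e he,
      IdealFiltration.coe_extendedReesMap]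
  · rw [RingHom.comp_apply, RingEquiv.toRingHom_eq_coe, RingEquiv.coe_toRingHom,
      IdealFiltration.extendedReesMap_algebraMap, apply_algebraMap_eq e.symm (coe_symm_apply_eq e he)]
  · rw [RingHom.comp_apply, RingEquiv.toRingHom_eq_coe, RingEquiv.coe_toRingHom,
      IdealFiltration.extendedReesMap_T, ← F'.ringEquiv_tInv e he, e.symm_apply_apply]
  · letI := ((weightedFiltration U W).extendedReesMap F' hle).toAlgebra
    haveI := (weightedFiltration U W).isLocalization_extendedRees F' 𝔮.primeCompl heq
    exact (IsLocalization.isLocalization_iff_of_ringEquiv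
      (𝔮.primeCompl.map (algebraMap A (weightedFiltration U W).extendedRees)) e.symm).mp this

/-- **(vii) FULL COMPATIBILITY ON `B`** (res-type-005's (vi)): with the map `ψ` above, for a prime `𝔫` of `B` missing `A ∖ 𝔮` there are
a prime `𝔫'` of `extReesAlgebra I'` and ONE `g : B_𝔫 ≃+* (extReesAlgebra I')_{𝔫'}` with `g (b/1) = (ψ b)/1` for EVERY `b ∈ B`
(hence (i)–(v) of `exists_prime_localMove_ringEquiv`, and the transform `f = t⁻ᵃ g` is carried to `ψ f = t⁻ᵃ ψ g`), `𝔫 = ψ⁻¹ 𝔫'`.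
[cite: Wlodarczyk2022, Def. 5.1.1] -/
theorem exists_ringHom_prime_ringEquiv_localMove {A : Type} [CommRing A] {m : ℕ} (U : Fin m → A) (W : Fin m → ℕ)
    (𝔮 : Ideal A) [𝔮.IsPrime] {I' : ℕ → Ideal (Localization.AtPrime 𝔮)}
    (hI' : ∀ n, I' n = ((weightedFiltration U W).ideal n).map (algebraMap A (Localization.AtPrime 𝔮)))
    (𝔫 : Ideal (weightedFiltration U W).extendedRees) [𝔫.IsPrime]
    (hd : Disjoint ((𝔮.primeCompl.map (algebraMap A (weightedFiltration U W).extendedRees) :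
      Submonoid (weightedFiltration U W).extendedRees) : Set (weightedFiltration U W).extendedRees) 𝔫) :
    ∃ (ψ : (weightedFiltration U W).extendedRees →+* extReesAlgebra I') (𝔫' : Ideal (extReesAlgebra I')) (_ : 𝔫'.IsPrime)
      (g : Localization.AtPrime 𝔫 ≃+* Localization.AtPrime 𝔫'),
      (∀ b : (weightedFiltration U W).extendedRees, ((ψ b : extReesAlgebra I') : (Localization.AtPrime 𝔮)[T;T⁻¹]) =
          AddMonoidAlgebra.mapRingHom ℤ (algebraMap A (Localization.AtPrime 𝔮)) (b : A[T;T⁻¹])) ∧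
      (∀ a : A, ψ (algebraMap A (weightedFiltration U W).extendedRees a) =
          algebraMap (Localization.AtPrime 𝔮) (extReesAlgebra I') (algebraMap A (Localization.AtPrime 𝔮) a)) ∧
      ψ (⟨T (-1), (weightedFiltration U W).T_neg_one_mem_extendedRees⟩ : (weightedFiltration U W).extendedRees) =
        extReesAlgebra.tInv I' ∧
      𝔫'.comap ψ = 𝔫 ∧
      ∀ b : (weightedFiltration U W).extendedRees,
        g (algebraMap (weightedFiltration U W).extendedRees (Localization.AtPrime 𝔫) b) =
          algebraMap (extReesAlgebra I') (Localization.AtPrime 𝔫') (ψ b) := by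
  let F' : IdealFiltration (Localization.AtPrime 𝔮) :=
    { ideal := I'
      ideal_zero := by rw [hI' 0, (weightedFiltration U W).ideal_zero, Ideal.map_top]
      antitone := fun a b h => by rw [hI' a, hI' b]; exact Ideal.map_mono ((weightedFiltration U W).antitone h)
      mul_le := fun a b => by
        rw [hI' a, hI' b, hI' (a + b), ← Ideal.map_mul]
        exact Ideal.map_mono ((weightedFiltration U W).mul_le a b) }
  have heq : ∀ n, F'.ideal n = ((weightedFiltration U W).ideal n).map (algebraMap A (Localization.AtPrime 𝔮)) := hI'
  have hle : ∀ n, ((weightedFiltration U W).ideal n).map (algebraMap A (Localization.AtPrime 𝔮)) ≤ F'.ideal n :=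
    fun n => (heq n).ge
  have hF'I : F'.ideal = I' := rfl
  obtain ⟨e, he⟩ := F'.exists_ringEquiv_extReesAlgebra hF'I
  haveI := (weightedFiltration U W).isPrime_map_extendedReesMap F' 𝔮.primeCompl heq 𝔫 hd
  obtain ⟨g, hg⟩ := (weightedFiltration U W).exists_ringEquiv_localization_extReesAlgebra F' 𝔮.primeCompl heq 𝔫 hd e
  refine ⟨e.symm.toRingHom.comp ((weightedFiltration U W).extendedReesMap F' hle), _, inferInstance, g,
    fun b => ?_, fun a => ?_, ?_, ?_, fun b => ?_⟩
  · rw [RingHom.comp_apply, RingEquiv.toRingHom_eq_coe, RingEquiv.coe_toRingHom, coe_symm_apply_eq e he,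
      IdealFiltration.coe_extendedReesMap]
  · rw [RingHom.comp_apply, RingEquiv.toRingHom_eq_coe, RingEquiv.coe_toRingHom,
      IdealFiltration.extendedReesMap_algebraMap, apply_algebraMap_eq e.symm (coe_symm_apply_eq e he)]
  · rw [RingHom.comp_apply, RingEquiv.toRingHom_eq_coe, RingEquiv.coe_toRingHom,
      IdealFiltration.extendedReesMap_T, ← F'.ringEquiv_tInv e he, e.symm_apply_apply]
  · -- `ψ⁻¹ 𝔫' = 𝔫`: `𝔫' = (𝔫 B').map e⁻¹`, contract in two steps
    ext x
    rw [Ideal.mem_comap, RingHom.comp_apply, RingEquiv.toRingHom_eq_coe, RingEquiv.coe_toRingHom,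
      Ideal.apply_mem_of_equiv_iff (f := e.symm), ← Ideal.mem_comap,
      (weightedFiltration U W).comap_map_extendedReesMap F' 𝔮.primeCompl heq 𝔫 hd]
  · rw [hg, RingHom.comp_apply, RingEquiv.toRingHom_eq_coe, RingEquiv.coe_toRingHom]

/-! ## rev 3: the same two packages with SOURCE `extReesAlgebra (weightedMonomialIdeal U W)` (res-type-047's letters for `B`)
The two source types are EQUAL subalgebras of `A[t, t⁻¹]` (`extReesAlgebra_weightedMonomialIdeal_eq_extendedRees`, res-type-048); the transfer
is by substitution along that equality, with the distinguished element `t⁻¹` carried as «the member whose Laurent polynomial is `T⁻¹`». -/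

/-- Transfer of (G2′) to any subalgebra `S` EQUAL to the global move, with `t⁻¹` given as a member of `S` lying over `T⁻¹`. [folklore] -/
theorem exists_ringHom_localMove_isLocalization_of_eq {A : Type} [CommRing A] {m : ℕ} (U : Fin m → A) (W : Fin m → ℕ)
    (𝔮 : Ideal A) [𝔮.IsPrime] {I' : ℕ → Ideal (Localization.AtPrime 𝔮)}
    (hI' : ∀ n, I' n = ((weightedFiltration U W).ideal n).map (algebraMap A (Localization.AtPrime 𝔮)))
    (S : Subalgebra A A[T;T⁻¹]) (hS : S = (weightedFiltration U W).extendedRees) (t : S) (ht : (t : A[T;T⁻¹]) = T (-1)) :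
    ∃ ψ : S →+* extReesAlgebra I',
      (∀ b : S, ((ψ b : extReesAlgebra I') : (Localization.AtPrime 𝔮)[T;T⁻¹]) =
          AddMonoidAlgebra.mapRingHom ℤ (algebraMap A (Localization.AtPrime 𝔮)) (b : A[T;T⁻¹])) ∧
      (∀ a : A, ψ (algebraMap A S a) =
          algebraMap (Localization.AtPrime 𝔮) (extReesAlgebra I') (algebraMap A (Localization.AtPrime 𝔮) a)) ∧
      ψ t = extReesAlgebra.tInv I' ∧
      @IsLocalization _ _ (𝔮.primeCompl.map (algebraMap A S)) (extReesAlgebra I') _ ψ.toAlgebra := by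
  subst hS
  have htt : t = ⟨T (-1), (weightedFiltration U W).T_neg_one_mem_extendedRees⟩ := Subtype.ext ht
  subst htt
  exact exists_ringHom_localMove_isLocalization U W 𝔮 hI'

/-- **(G2′) with source `B = extReesAlgebra (weightedMonomialIdeal U W)`**: for ANY presentation `I'` of the localised pieces
(`I' n = (weightedMonomialIdeal U W n) A_𝔮`; for the literal local move `I' n = weightedMonomialIdeal (U/1) W n` the binder `hI'` is
`fun n => (weightedMonomialIdeal_map _ U W n).symm`) a ring map `ψ : B → extReesAlgebra I'`, coefficientwise the localisation `A → A_𝔮` on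
Laurent polynomials, matching structure maps, `ψ tInv = tInv`, and `extReesAlgebra I'` IS the localisation of `B` at the image of
`A ∖ 𝔮` (`IsLocalization (Algebra.algebraMapSubmonoid B 𝔮.primeCompl) (extReesAlgebra I')` for `ψ.toAlgebra`). [cite: Wlodarczyk2022, Def. 5.1.1] -/
theorem exists_ringHom_localMove_isLocalization' {A : Type} [CommRing A] {m : ℕ} (U : Fin m → A) (W : Fin m → ℕ)
    (𝔮 : Ideal A) [𝔮.IsPrime] {I' : ℕ → Ideal (Localization.AtPrime 𝔮)}
    (hI' : ∀ n, I' n = (weightedMonomialIdeal U W n).map (algebraMap A (Localization.AtPrime 𝔮))) :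
    ∃ ψ : extReesAlgebra (weightedMonomialIdeal U W) →+* extReesAlgebra I',
      (∀ b : extReesAlgebra (weightedMonomialIdeal U W), ((ψ b : extReesAlgebra I') : (Localization.AtPrime 𝔮)[T;T⁻¹]) =
          AddMonoidAlgebra.mapRingHom ℤ (algebraMap A (Localization.AtPrime 𝔮)) (b : A[T;T⁻¹])) ∧
      (∀ a : A, ψ (algebraMap A (extReesAlgebra (weightedMonomialIdeal U W)) a) =
          algebraMap (Localization.AtPrime 𝔮) (extReesAlgebra I') (algebraMap A (Localization.AtPrime 𝔮) a)) ∧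
      ψ (extReesAlgebra.tInv (weightedMonomialIdeal U W)) = extReesAlgebra.tInv I' ∧
      @IsLocalization _ _ (𝔮.primeCompl.map (algebraMap A (extReesAlgebra (weightedMonomialIdeal U W)))) (extReesAlgebra I') _
        ψ.toAlgebra :=
  exists_ringHom_localMove_isLocalization_of_eq U W 𝔮 (fun n => by rw [weightedFiltration_ideal_eq]; exact hI' n)
    (extReesAlgebra (weightedMonomialIdeal U W)) (extReesAlgebra_weightedMonomialIdeal_eq_extendedRees U W)
    (extReesAlgebra.tInv (weightedMonomialIdeal U W)) (extReesAlgebra.coe_tInv _)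

/-- Transfer of (vii) to any subalgebra `S` EQUAL to the global move, with `t⁻¹` given as a member of `S` lying over `T⁻¹`. [folklore] -/
theorem exists_ringHom_prime_ringEquiv_localMove_of_eq {A : Type} [CommRing A] {m : ℕ} (U : Fin m → A) (W : Fin m → ℕ)
    (𝔮 : Ideal A) [𝔮.IsPrime] {I' : ℕ → Ideal (Localization.AtPrime 𝔮)}
    (hI' : ∀ n, I' n = ((weightedFiltration U W).ideal n).map (algebraMap A (Localization.AtPrime 𝔮)))
    (S : Subalgebra A A[T;T⁻¹]) (hS : S = (weightedFiltration U W).extendedRees) (t : S) (ht : (t : A[T;T⁻¹]) = T (-1))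
    (𝔫 : Ideal S) [𝔫.IsPrime] (hd : Disjoint ((𝔮.primeCompl.map (algebraMap A S) : Submonoid S) : Set S) 𝔫) :
    ∃ (ψ : S →+* extReesAlgebra I') (𝔫' : Ideal (extReesAlgebra I')) (_ : 𝔫'.IsPrime)
      (g : Localization.AtPrime 𝔫 ≃+* Localization.AtPrime 𝔫'),
      (∀ b : S, ((ψ b : extReesAlgebra I') : (Localization.AtPrime 𝔮)[T;T⁻¹]) =
          AddMonoidAlgebra.mapRingHom ℤ (algebraMap A (Localization.AtPrime 𝔮)) (b : A[T;T⁻¹])) ∧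
      (∀ a : A, ψ (algebraMap A S a) =
          algebraMap (Localization.AtPrime 𝔮) (extReesAlgebra I') (algebraMap A (Localization.AtPrime 𝔮) a)) ∧
      ψ t = extReesAlgebra.tInv I' ∧
      𝔫'.comap ψ = 𝔫 ∧
      ∀ b : S, g (algebraMap S (Localization.AtPrime 𝔫) b) = algebraMap (extReesAlgebra I') (Localization.AtPrime 𝔫') (ψ b) := by
  subst hS
  have htt : t = ⟨T (-1), (weightedFiltration U W).T_neg_one_mem_extendedRees⟩ := Subtype.ext ht
  subst htt
  exact exists_ringHom_prime_ringEquiv_localMove U W 𝔮 hI' 𝔫 hd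

/-- **(vii) with source `B = extReesAlgebra (weightedMonomialIdeal U W)`**: for a prime `𝔫` of `B` missing `A ∖ 𝔮`, a prime `𝔫'` of the
local move `extReesAlgebra I'` with `ψ⁻¹ 𝔫' = 𝔫` and ONE `g : B_𝔫 ≃+* (extReesAlgebra I')_{𝔫'}` with `g (b/1) = (ψ b)/1` for EVERY `b ∈ B`,
`ψ` as in `exists_ringHom_localMove_isLocalization'` (coefficientwise, structure maps, `tInv ↦ tInv`). [cite: Wlodarczyk2022, Def. 5.1.1] -/
theorem exists_ringHom_prime_ringEquiv_localMove' {A : Type} [CommRing A] {m : ℕ} (U : Fin m → A) (W : Fin m → ℕ)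
    (𝔮 : Ideal A) [𝔮.IsPrime] {I' : ℕ → Ideal (Localization.AtPrime 𝔮)}
    (hI' : ∀ n, I' n = (weightedMonomialIdeal U W n).map (algebraMap A (Localization.AtPrime 𝔮)))
    (𝔫 : Ideal (extReesAlgebra (weightedMonomialIdeal U W))) [𝔫.IsPrime]
    (hd : Disjoint ((𝔮.primeCompl.map (algebraMap A (extReesAlgebra (weightedMonomialIdeal U W))) :
      Submonoid (extReesAlgebra (weightedMonomialIdeal U W))) : Set (extReesAlgebra (weightedMonomialIdeal U W))) 𝔫) :
    ∃ (ψ : extReesAlgebra (weightedMonomialIdeal U W) →+* extReesAlgebra I') (𝔫' : Ideal (extReesAlgebra I')) (_ : 𝔫'.IsPrime)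
      (g : Localization.AtPrime 𝔫 ≃+* Localization.AtPrime 𝔫'),
      (∀ b : extReesAlgebra (weightedMonomialIdeal U W), ((ψ b : extReesAlgebra I') : (Localization.AtPrime 𝔮)[T;T⁻¹]) =
          AddMonoidAlgebra.mapRingHom ℤ (algebraMap A (Localization.AtPrime 𝔮)) (b : A[T;T⁻¹])) ∧
      (∀ a : A, ψ (algebraMap A (extReesAlgebra (weightedMonomialIdeal U W)) a) =
          algebraMap (Localization.AtPrime 𝔮) (extReesAlgebra I') (algebraMap A (Localization.AtPrime 𝔮) a)) ∧
      ψ (extReesAlgebra.tInv (weightedMonomialIdeal U W)) = extReesAlgebra.tInv I' ∧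
      𝔫'.comap ψ = 𝔫 ∧
      ∀ b : extReesAlgebra (weightedMonomialIdeal U W),
        g (algebraMap (extReesAlgebra (weightedMonomialIdeal U W)) (Localization.AtPrime 𝔫) b) =
          algebraMap (extReesAlgebra I') (Localization.AtPrime 𝔫') (ψ b) :=
  exists_ringHom_prime_ringEquiv_localMove_of_eq U W 𝔮 (fun n => by rw [weightedFiltration_ideal_eq]; exact hI' n)
    (extReesAlgebra (weightedMonomialIdeal U W)) (extReesAlgebra_weightedMonomialIdeal_eq_extendedRees U W)
    (extReesAlgebra.tInv (weightedMonomialIdeal U W)) (extReesAlgebra.coe_tInv _) 𝔫 hd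

/-! ## rev 4: uniqueness of `ψ`, and the LOCAL → GLOBAL direction of the prime dictionary
(res-type-047's «a no-drop successor of the local move at a tie point IS a point of the global no-drop locus») -/

/-- **A ring map between subalgebras of Laurent polynomial rings that is coefficientwise `φ` is UNIQUE** — so the `ψ` of
`exists_ringHom_localMove_isLocalization'` and the `ψ` of `exists_ringHom_prime_ringEquiv_localMove'` are the same map, and a
consumer may use the `IsLocalization` clause of the one with the `g` of the other. [folklore] -/
theorem ringHom_eq_of_coe_eq_mapRingHom {A A' : Type} [CommRing A] [CommRing A'] (φ : A →+* A')
    {S : Subalgebra A A[T;T⁻¹]} {S' : Subalgebra A' A'[T;T⁻¹]} (ψ₁ ψ₂ : S →+* S')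
    (h₁ : ∀ b : S, ((ψ₁ b : S') : A'[T;T⁻¹]) = AddMonoidAlgebra.mapRingHom ℤ φ (b : A[T;T⁻¹]))
    (h₂ : ∀ b : S, ((ψ₂ b : S') : A'[T;T⁻¹]) = AddMonoidAlgebra.mapRingHom ℤ φ (b : A[T;T⁻¹])) : ψ₁ = ψ₂ :=
  RingHom.ext fun b => Subtype.ext ((h₁ b).trans (h₂ b).symm)

/-- **Primes of the local move contract to primes of the global move missing `A ∖ 𝔮`** (the elements of `A ∖ 𝔮` become units in
`A_𝔮 ⊆ extReesAlgebra I'`). [folklore] -/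
theorem disjoint_comap_of_localMove {A : Type} [CommRing A] {m : ℕ} (U : Fin m → A) (W : Fin m → ℕ) (𝔮 : Ideal A) [𝔮.IsPrime]
    {I' : ℕ → Ideal (Localization.AtPrime 𝔮)} (ψ : extReesAlgebra (weightedMonomialIdeal U W) →+* extReesAlgebra I')
    (hψa : ∀ a : A, ψ (algebraMap A (extReesAlgebra (weightedMonomialIdeal U W)) a) =
      algebraMap (Localization.AtPrime 𝔮) (extReesAlgebra I') (algebraMap A (Localization.AtPrime 𝔮) a))
    (𝔫' : Ideal (extReesAlgebra I')) [𝔫'.IsPrime] :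
    Disjoint ((𝔮.primeCompl.map (algebraMap A (extReesAlgebra (weightedMonomialIdeal U W))) :
      Submonoid (extReesAlgebra (weightedMonomialIdeal U W))) : Set (extReesAlgebra (weightedMonomialIdeal U W))) (𝔫'.comap ψ) := by
  refine Set.disjoint_left.mpr ?_
  rintro _ ⟨s, hs, rfl⟩ hmem
  rw [SetLike.mem_coe, Ideal.mem_comap, hψa] at hmem
  have hu : IsUnit (algebraMap (Localization.AtPrime 𝔮) (extReesAlgebra I') (algebraMap A (Localization.AtPrime 𝔮) s)) :=
    (IsLocalization.map_units (Localization.AtPrime 𝔮) ⟨s, hs⟩).map _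
  exact ‹𝔫'.IsPrime›.ne_top (Ideal.eq_top_of_isUnit_mem _ hmem hu)

/-- **LOCAL → GLOBAL: every prime `𝔫'` of the local move `extReesAlgebra I'` at `𝔮` is the image of the prime `ψ⁻¹ 𝔫'` of the global
move, with isomorphic local rings.**  For ANY presentation `I'` (`I' n = 𝒥_n(U, W) A_𝔮`) and any prime `𝔫'` of `extReesAlgebra I'`:
ONE ring map `ψ : B = extReesAlgebra (weightedMonomialIdeal U W) → extReesAlgebra I'` (coefficientwise `A → A_𝔮`, structure maps,
`tInv ↦ tInv`, and `extReesAlgebra I'` IS the localisation of `B` at the image of `A ∖ 𝔮` for `ψ`) together with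
`g : B_{ψ⁻¹ 𝔫'} ≃+* (extReesAlgebra I')_{𝔫'}` satisfying `g (b/1) = (ψ b)/1` on all of `B`.  (So a no-drop successor of the LOCAL move at a
point `𝔮` of the curve is read at the point `ψ⁻¹ 𝔫'` of `Spec B`: `t⁻¹ ∈ ψ⁻¹𝔫'`, `X ∉ ψ⁻¹𝔫'`, same order of the transform — the
consumer kit `…GlobalMoveDictionary`.) [cite: Wlodarczyk2022, Def. 5.1.1] -/
theorem exists_ringHom_ringEquiv_of_prime_localMove' {A : Type} [CommRing A] {m : ℕ} (U : Fin m → A) (W : Fin m → ℕ)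
    (𝔮 : Ideal A) [𝔮.IsPrime] {I' : ℕ → Ideal (Localization.AtPrime 𝔮)}
    (hI' : ∀ n, I' n = (weightedMonomialIdeal U W n).map (algebraMap A (Localization.AtPrime 𝔮)))
    (𝔫' : Ideal (extReesAlgebra I')) [𝔫'.IsPrime] :
    ∃ (ψ : extReesAlgebra (weightedMonomialIdeal U W) →+* extReesAlgebra I')
      (g : Localization.AtPrime (𝔫'.comap ψ) ≃+* Localization.AtPrime 𝔫'),
      (∀ b : extReesAlgebra (weightedMonomialIdeal U W), ((ψ b : extReesAlgebra I') : (Localization.AtPrime 𝔮)[T;T⁻¹]) =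
          AddMonoidAlgebra.mapRingHom ℤ (algebraMap A (Localization.AtPrime 𝔮)) (b : A[T;T⁻¹])) ∧
      (∀ a : A, ψ (algebraMap A (extReesAlgebra (weightedMonomialIdeal U W)) a) =
          algebraMap (Localization.AtPrime 𝔮) (extReesAlgebra I') (algebraMap A (Localization.AtPrime 𝔮) a)) ∧
      ψ (extReesAlgebra.tInv (weightedMonomialIdeal U W)) = extReesAlgebra.tInv I' ∧
      @IsLocalization _ _ (𝔮.primeCompl.map (algebraMap A (extReesAlgebra (weightedMonomialIdeal U W)))) (extReesAlgebra I') _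
        ψ.toAlgebra ∧
      ∀ b : extReesAlgebra (weightedMonomialIdeal U W),
        g (algebraMap (extReesAlgebra (weightedMonomialIdeal U W)) (Localization.AtPrime (𝔫'.comap ψ)) b) =
          algebraMap (extReesAlgebra I') (Localization.AtPrime 𝔫') (ψ b) := by
  obtain ⟨ψ, hψc, hψa, hψt, hloc⟩ := exists_ringHom_localMove_isLocalization' U W 𝔮 hI'
  haveI : (𝔫'.comap ψ).IsPrime := Ideal.comap_isPrime ψ 𝔫'
  have hd := disjoint_comap_of_localMove U W 𝔮 ψ hψa 𝔫'
  obtain ⟨ψ₂, 𝔫'', h𝔫'', g, hψ₂c, hψ₂a, hψ₂t, hcomap, hg⟩ :=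
    exists_ringHom_prime_ringEquiv_localMove' U W 𝔮 hI' (𝔫'.comap ψ) hd
  -- the two maps agree (both are coefficientwise the localisation), and then `𝔫'' = 𝔫'` (both lie over `ψ⁻¹ 𝔫'`)
  have hψeq : ψ₂ = ψ := ringHom_eq_of_coe_eq_mapRingHom _ ψ₂ ψ hψ₂c hψc
  subst hψeq
  have h𝔫 : 𝔫'' = 𝔫' := by
    letI := ψ₂.toAlgebra
    haveI := hloc
    have h1 := IsLocalization.map_under
      (𝔮.primeCompl.map (algebraMap A (extReesAlgebra (weightedMonomialIdeal U W)))) (S := extReesAlgebra I') 𝔫''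
    have h2 := IsLocalization.map_under
      (𝔮.primeCompl.map (algebraMap A (extReesAlgebra (weightedMonomialIdeal U W)))) (S := extReesAlgebra I') 𝔫'
    rw [Ideal.under_def, RingHom.algebraMap_toAlgebra] at h1 h2
    rw [← h1, ← h2, hcomap]
  subst h𝔫
  exact ⟨ψ₂, g, hψ₂c, hψ₂a, hψ₂t, hloc, hg⟩

end ContactCylinder

end Summit.ResolutionOfSingularities.ResolutionOfSingularities.Theorems

end
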